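import Literature.MathematicalPhysics.QuantumLattice.MeanEnergyMinimisersAreGroundStates
import HarnessLib

/-!
# Bratteli–Kishimoto–Robinson Theorem 2 for the `t–t'` Hubbard interaction (both directions)

Topic `Literature/MathematicalPhysics/QuantumLattice`; namespace
`Literature.MathematicalPhysics.QuantumLattice` (the file path). Companion of
`MeanEnergyMinimisersAreGroundStates.lean` (`2 ⇒ 1`, general even finite-range interactions) and
`FermionGroundStatesMinimiseMeanEnergy.lean` (`1 ⇒ 2` for the `t–t'` Hubbard interaction).
Everything is PROVED; no named fact.

* the nearest-neighbour Hubbard interaction `hubbardFermionInteraction d t U`, the diagonal hopping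
  `diagHoppingFermionInteraction t'` and the `t–t'` interaction `hubbardTTPrimeFermionInteraction t t' U`
  have FINITE RANGE `1` and are TRANSLATION INVARIANT (`…_hasFiniteRange`, `…_isTranslationInvariant`);
* `InfVolFermionState.isMeanEnergyMinimiser_ttPrime_iff`: for every state `ω` of the planar lattice
  fermions and all real `t, t', U`,
  `ω.IsMeanEnergyMinimiser Ψ 1 ↔ ω.IsTranslationInvariant ∧ ω.IsGroundState Ψ 1`,
  `Ψ = hubbardTTPrimeFermionInteraction t t' U` — Bratteli–Kishimoto–Robinson's Theorem 2 (`1 ⇔ 2`) for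
  the `t–t'` Hubbard model: the translation-invariant ground states are exactly the
  translation-invariant minimisers of the mean energy.

## References

* [BratteliKishimotoRobinson1978] Commun. Math. Phys. 64 (1978) 41–48, Thm. 2.
* [XuEtAl2024] the `t–t'` Hubbard Hamiltonian, eq. (1).
* [ArakiMoriya2003] §1 (IV), §8 (translation-invariant even potentials of finite range).
-/

noncomputable section

namespace Literature.MathematicalPhysics.QuantumLattice

open Matrix Finset HubbardWave0 Literature.Probability.LatticeModels
open scoped ComplexOrder

variable {d : ℕ}

/-! ### §1. Translated singletons and pairs -/

/-- `{x} + v = {x + v}`. [cite: ArakiMoriya2003, §4.1 Def. 4.3 (lattice translations)] -/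
theorem shiftSet_singleton_eq (v x : Site d) : shiftSet v ({x} : Finset (Site d)) = {x + v} := by
  ext y
  rw [mem_shiftSet, Finset.mem_singleton, Finset.mem_singleton, sub_eq_iff_eq_add]

/-- `{x, y} + v = {x + v, y + v}`. [cite: ArakiMoriya2003, §4.1 Def. 4.3 (lattice translations)] -/
theorem shiftSet_pair_eq (v x y : Site d) : shiftSet v ({x, y} : Finset (Site d)) = {x + v, y + v} := by
  ext z
  rw [mem_shiftSet, Finset.mem_insert, Finset.mem_singleton, Finset.mem_insert, Finset.mem_singleton,
    sub_eq_iff_eq_add, sub_eq_iff_eq_add]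

/-- If `X + v = {y}` then `X = {y - v}`. [cite: ArakiMoriya2003, §4.1 Def. 4.3 (lattice translations)] -/
theorem eq_singleton_of_shiftSet_eq {v : Site d} {X : Finset (Site d)} {y : Site d}
    (h : shiftSet v X = {y}) : X = {y - v} := by
  rw [← KrausPattern.shiftSet_neg_shiftSet v X, h, shiftSet_singleton_eq, ← sub_eq_add_neg]

/-- If `X + v = {y, z}` then `X = {y - v, z - v}`. [cite: ArakiMoriya2003, §4.1 Def. 4.3 (lattice translations)] -/
theorem eq_pair_of_shiftSet_eq {v : Site d} {X : Finset (Site d)} {y z : Site d}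
    (h : shiftSet v X = {y, z}) : X = {y - v, z - v} := by
  rw [← KrausPattern.shiftSet_neg_shiftSet v X, h, shiftSet_pair_eq, ← sub_eq_add_neg, ← sub_eq_add_neg]

/-! ### §2. The terms at a region known to be a singleton / a bond -/

section Terms

variable (t U : ℝ)

/-- On-site term at a region `S = {y}`. [cite: arXiv9311033, §2 (the Hubbard Hamiltonian)] -/
theorem hubbardFermionInteraction_apply_of_eq_singleton {S : Finset (Site d)} {y : Site d} (hS : S = {y})
    (hy : y ∈ S) :
    (hubbardFermionInteraction d t U).Φ S = (U : ℂ) • (nAt y hy 0 * nAt y hy 1) := by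
  subst hS
  exact hubbardFermionInteraction_apply_singleton t U y

/-- Bond term at a region `S = {y, z}`, `z = y + e_i`. [cite: arXiv9311033, §2 (the Hubbard Hamiltonian)] -/
theorem hubbardFermionInteraction_apply_of_eq_pair {S : Finset (Site d)} {y z : Site d} {i : Fin d}
    (hS : S = {y, z}) (hz : z = y + unitVec i) (hy : y ∈ S) (hz' : z ∈ S) :
    (hubbardFermionInteraction d t U).Φ S =
      -(t : ℂ) • ∑ σ : Fin 2, ((cAt y hy σ)ᴴ * cAt z hz' σ + (cAt z hz' σ)ᴴ * cAt y hy σ) := by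
  subst hz; subst hS
  exact hubbardFermionInteraction_apply_pair t U y i

/-- Diagonal bond term at a region `S = {y, z}`, `z = y + j_s`. [cite: XuEtAl2024, eq. (1)] -/
theorem diagHoppingFermionInteraction_apply_of_eq_pair (t' : ℝ) {S : Finset (Site 2)} {y z : Site 2}
    {s : Fin 2} (hS : S = {y, z}) (hz : z = y + diagVec s) (hy : y ∈ S) (hz' : z ∈ S) :
    (diagHoppingFermionInteraction t').Φ S =
      -(t' : ℂ) • ∑ σ : Fin 2, ((cAt y hy σ)ᴴ * cAt z hz' σ + (cAt z hz' σ)ᴴ * cAt y hy σ) := by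
  subst hz; subst hS
  exact diagHoppingFermionInteraction_apply_pair t' y s

end Terms

/-! ### §3. Translation invariance -/

/-- A pointwise sum of translation-invariant interactions is translation invariant.
[cite: ArakiMoriya2003, §1 assumption (IV)] -/
theorem FermionInteraction.isTranslationInvariant_of_add {Ψ Ψ₁ Ψ₂ : FermionInteraction d}
    (h : ∀ X, Ψ.Φ X = Ψ₁.Φ X + Ψ₂.Φ X) (h₁ : Ψ₁.IsTranslationInvariant) (h₂ : Ψ₂.IsTranslationInvariant) :
    Ψ.IsTranslationInvariant := fun v X => by
  rw [h, h, map_add, h₁ v X, h₂ v X]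

/-- A pointwise sum of interactions of range `R` has range `R`. [cite: ArakiMoriya2003, §5.4 (finite range)] -/
theorem FermionInteraction.hasFiniteRange_of_add {Ψ Ψ₁ Ψ₂ : FermionInteraction d} {R : ℝ}
    (h : ∀ X, Ψ.Φ X = Ψ₁.Φ X + Ψ₂.Φ X) (h₁ : Ψ₁.HasFiniteRange R) (h₂ : Ψ₂.HasFiniteRange R) :
    Ψ.HasFiniteRange R := fun X hX => by
  rw [h, h₁ X hX, h₂ X hX, add_zero]

/-- **The Hubbard interaction is translation invariant**: `Φ(X + v) = Γ(τ_v)(Φ X)`.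
[cite: ArakiMoriya2003, §1 assumption (IV) and §8] -/
theorem hubbardFermionInteraction_isTranslationInvariant (t U : ℝ) :
    (hubbardFermionInteraction d t U).IsTranslationInvariant := by
  intro v X
  by_cases h1 : ∃ x : Site d, X = {x}
  · obtain ⟨x, rfl⟩ := h1
    rw [hubbardFermionInteraction_apply_of_eq_singleton t U (shiftSet_singleton_eq v x)
        (PolySite.add_mem_shiftSet v (Finset.mem_singleton_self x)),
      hubbardFermionInteraction_apply_singleton, map_smul, map_mul, nAt, nAt, fermionEmbed_numberOp,
      fermionEmbed_numberOp, PolySite.shiftEmb_pt]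
  by_cases h2 : ∃ (x : Site d) (i : Fin d), X = {x, x + unitVec i}
  · obtain ⟨x, i, rfl⟩ := h2
    rw [hubbardFermionInteraction_apply_of_eq_pair t U (shiftSet_pair_eq v x (x + unitVec i))
        (add_right_comm x (unitVec i) v) (PolySite.add_mem_shiftSet v (Finset.mem_insert_self _ _))
        (PolySite.add_mem_shiftSet v (Finset.mem_insert_of_mem (Finset.mem_singleton_self _))),
      hubbardFermionInteraction_apply_pair, map_smul, map_sum]
    simp only [map_add, map_mul, fermionEmbed_conjTranspose, fermionEmbed_shiftEmb_cAt]
  -- otherwise both sides vanish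
  have hX : (hubbardFermionInteraction d t U).Φ X = 0 :=
    hubbardFermionInteraction_apply_eq_zero t U (fun x hx => h1 ⟨x, hx⟩) (fun x i hx => h2 ⟨x, i, hx⟩)
  have hS : (hubbardFermionInteraction d t U).Φ (shiftSet v X) = 0 := by
    refine hubbardFermionInteraction_apply_eq_zero t U (fun y hy => h1 ⟨y - v, eq_singleton_of_shiftSet_eq hy⟩)
      (fun y i hy => h2 ⟨y - v, i, ?_⟩)
    rw [eq_pair_of_shiftSet_eq hy, add_sub_right_comm]
  rw [hX, hS, map_zero]

/-- **The diagonal hopping interaction is translation invariant.** [cite: ArakiMoriya2003, §1 assumption (IV) and §8] -/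
theorem diagHoppingFermionInteraction_isTranslationInvariant (t' : ℝ) :
    (diagHoppingFermionInteraction t').IsTranslationInvariant := by
  intro v X
  by_cases h3 : ∃ (x : Site 2) (s : Fin 2), X = {x, x + diagVec s}
  · obtain ⟨x, s, rfl⟩ := h3
    rw [diagHoppingFermionInteraction_apply_of_eq_pair t' (shiftSet_pair_eq v x (x + diagVec s))
        (add_right_comm x (diagVec s) v) (PolySite.add_mem_shiftSet v (Finset.mem_insert_self _ _))
        (PolySite.add_mem_shiftSet v (Finset.mem_insert_of_mem (Finset.mem_singleton_self _))),
      diagHoppingFermionInteraction_apply_pair, map_smul, map_sum]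
    simp only [map_add, map_mul, fermionEmbed_conjTranspose, fermionEmbed_shiftEmb_cAt]
  have hX : (diagHoppingFermionInteraction t').Φ X = 0 :=
    diagHoppingFermionInteraction_apply_eq_zero t' (fun x s hx => h3 ⟨x, s, hx⟩)
  have hS : (diagHoppingFermionInteraction t').Φ (shiftSet v X) = 0 := by
    refine diagHoppingFermionInteraction_apply_eq_zero t' (fun y s hy => h3 ⟨y - v, s, ?_⟩)
    rw [eq_pair_of_shiftSet_eq hy, add_sub_right_comm]
  rw [hX, hS, map_zero]

/-- **The `t–t'` Hubbard interaction is translation invariant.** [cite: ArakiMoriya2003, §1 assumption (IV) and §8] -/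
theorem hubbardTTPrimeFermionInteraction_isTranslationInvariant (t t' U : ℝ) :
    (hubbardTTPrimeFermionInteraction t t' U).IsTranslationInvariant :=
  FermionInteraction.isTranslationInvariant_of_add (hubbardTTPrimeFermionInteraction_apply t t' U)
    (hubbardFermionInteraction_isTranslationInvariant t U) (diagHoppingFermionInteraction_isTranslationInvariant t')

/-! ### §4. Finite range -/

/-- `‖e_i‖ = 1` in the sup norm of `ℤ^d`. [cite: ArakiMoriya2003, §5.4 (finite range)] -/
theorem norm_unitVec_site (i : Fin d) : ‖(unitVec i : Site d)‖ = 1 := by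
  rw [unitVec, Pi.norm_single, norm_one]

/-- `‖j_s‖ = 1` in the sup norm of `ℤ²`. [cite: ArakiMoriya2003, §5.4 (finite range)] -/
theorem norm_diagVec (s : Fin 2) : ‖(diagVec s : Site 2)‖ = 1 := by
  refine le_antisymm ((pi_norm_le_iff_of_nonneg zero_le_one).2 fun j => ?_) ?_
  · rw [Int.norm_eq_abs]
    exact_mod_cast (abs_diagVec_apply s j).le
  · have h := norm_le_pi_norm (diagVec s : Site 2) 0
    rw [Int.norm_eq_abs] at h
    have h1 : |diagVec s 0| = 1 := abs_diagVec_apply s 0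
    have h1' : (|diagVec s 0| : ℝ) = 1 := by exact_mod_cast h1
    linarith

/-- The diameter of a bond `{x, x + u}` is `‖u‖`. [cite: ArakiMoriya2003, §5.4 (finite range)] -/
theorem diam_coe_pair_add (x u : Site d) :
    Metric.diam ((({x, x + u} : Finset (Site d)) : Set (Site d))) = ‖u‖ := by
  rw [Finset.coe_pair, Metric.diam_pair, dist_eq_norm, sub_add_cancel_left, norm_neg]

/-- **The Hubbard interaction has range `1`.** [cite: ArakiMoriya2003, §5.4 (finite range potentials)] -/
theorem hubbardFermionInteraction_hasFiniteRange (t U : ℝ) : (hubbardFermionInteraction d t U).HasFiniteRange 1 := by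
  intro X hX
  refine hubbardFermionInteraction_apply_eq_zero t U (fun x hx => ?_) (fun x i hx => ?_)
  · subst hx
    rw [Finset.coe_singleton, Metric.diam_singleton] at hX
    exact absurd hX (by norm_num)
  · subst hx
    rw [diam_coe_pair_add, norm_unitVec_site] at hX
    exact absurd hX (lt_irrefl _)

/-- **The diagonal hopping interaction has range `1`.** [cite: ArakiMoriya2003, §5.4 (finite range potentials)] -/
theorem diagHoppingFermionInteraction_hasFiniteRange (t' : ℝ) : (diagHoppingFermionInteraction t').HasFiniteRange 1 := by
  intro X hX
  refine diagHoppingFermionInteraction_apply_eq_zero t' (fun x s hx => ?_)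
  subst hx
  rw [diam_coe_pair_add, norm_diagVec] at hX
  exact absurd hX (lt_irrefl _)

/-- **The `t–t'` Hubbard interaction has range `1`.** [cite: ArakiMoriya2003, §5.4 (finite range potentials)] -/
theorem hubbardTTPrimeFermionInteraction_hasFiniteRange (t t' U : ℝ) :
    (hubbardTTPrimeFermionInteraction t t' U).HasFiniteRange 1 :=
  FermionInteraction.hasFiniteRange_of_add (hubbardTTPrimeFermionInteraction_apply t t' U)
    (hubbardFermionInteraction_hasFiniteRange t U) (diagHoppingFermionInteraction_hasFiniteRange t')

/-! ### §5. Bratteli–Kishimoto–Robinson's Theorem 2 for the Hubbard models -/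

namespace InfVolFermionState

/-- **`2 ⇒ 1` for the nearest-neighbour Hubbard interaction** on `ℤ^d`, `d ≥ 1`: a translation-invariant
minimiser of the mean energy of `hubbardFermionInteraction d t U` is a ground state.
[cite: BratteliKishimotoRobinson1978, Thm. 2] -/
theorem IsMeanEnergyMinimiser.isGroundState_hubbard (hd : 0 < d) {t U : ℝ} {ω : InfVolFermionState d}
    (hmin : ω.IsMeanEnergyMinimiser (hubbardFermionInteraction d t U) 1) :
    ω.IsGroundState (hubbardFermionInteraction d t U) 1 :=
  hmin.isGroundState hd (hubbardFermionInteraction_hasFiniteRange t U) (hubbardFermionInteraction_isHermitian t U)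
    (hubbardFermionInteraction_isEven t U) (hubbardFermionInteraction_isTranslationInvariant t U)

/-- **`2 ⇒ 1` for the `t–t'` Hubbard interaction**: a translation-invariant minimiser of the mean
energy of `hubbardTTPrimeFermionInteraction t t' U` is a ground state.
[cite: BratteliKishimotoRobinson1978, Thm. 2] -/
theorem IsMeanEnergyMinimiser.isGroundState_ttPrime {t t' U : ℝ} {ω : InfVolFermionState 2}
    (hmin : ω.IsMeanEnergyMinimiser (hubbardTTPrimeFermionInteraction t t' U) 1) :
    ω.IsGroundState (hubbardTTPrimeFermionInteraction t t' U) 1 :=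
  hmin.isGroundState two_pos (hubbardTTPrimeFermionInteraction_hasFiniteRange t t' U)
    (hubbardTTPrimeFermionInteraction_isHermitian t t' U) (hubbardTTPrimeFermionInteraction_isEven t t' U)
    (hubbardTTPrimeFermionInteraction_isTranslationInvariant t t' U)

/-- **Bratteli–Kishimoto–Robinson's Theorem 2 (`1 ⇔ 2`) for the `t–t'` Hubbard model on `ℤ²`**: a
state is a translation-invariant minimiser of the mean energy `e^{tt'}` if and only if it is a
translation-invariant ground state (`-i ω(A⋆δ(A)) ≥ 0` for all local `A`). (`1 ⇒ 2` is the tree's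
`IsGroundState.isMeanEnergyMinimiser_ttPrime`; `2 ⇒ 1` is `IsMeanEnergyMinimiser.isGroundState`.)
[cite: BratteliKishimotoRobinson1978, Thm. 2 (1 ⇔ 2)] -/
theorem isMeanEnergyMinimiser_ttPrime_iff {t t' U : ℝ} {ω : InfVolFermionState 2} :
    ω.IsMeanEnergyMinimiser (hubbardTTPrimeFermionInteraction t t' U) 1 ↔
      ω.IsTranslationInvariant ∧ ω.IsGroundState (hubbardTTPrimeFermionInteraction t t' U) 1 :=
  ⟨fun h => ⟨h.1, h.isGroundState_ttPrime⟩, fun h => h.2.isMeanEnergyMinimiser_ttPrime h.1⟩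

end InfVolFermionState

end Literature.MathematicalPhysics.QuantumLattice

end
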